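import Mathlib

/-!
# Crux `UniformPhotonSphereChannels` (K1), negative side — the near-horizon DECAY LEMMA

Support file of the standing disprover of item stmt-FinalStateConjecture-10045.  The horizon-side
census of the candidate non-radiative kernel `P(ρ)` ("the finite-energy `t`-polynomial solutions on
the near exterior cone are static") reduces, by finite differences in `t` and energy monotonicity,
to the following one-dimensional fact, proved here:

`KernelDecay.eq_zero_of_sq_integrableOn`: if `a'' = V a` on `(−∞, X)` with `V ≥ 0` continuous and
exponentially small at `−∞` (`V(x) ≤ C e^{κx}`, as the Regge–Wheeler potential on the tortoise
line, `κ = 1/2M`), and `∫_{−∞}^{X} a² < ∞`, then `a ≡ 0` on `(−∞, X)`.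

Proof (elementary, no asymptotic integration): `(a²)'' = 2a'² + 2Va² ≥ 0`, so with `a² ∈ L¹`
the function `a²` is non-decreasing with infimum `0`; on a maximal interval where `a > 0` one gets
`0 ≤ a' ≤ Φ a`, `Φ(x) = (C/κ)e^{κx}`, whence `a · exp(−(C/κ²)e^{κx})` is non-increasing and tends
to `0` at the left end — so `a ≤ 0`, a contradiction. [folklore]
-/

namespace Summit.FinalStateConjecture.FinalStateConjecture.Theorems

open MeasureTheory Set Filter Topology intervalIntegral

noncomputable section

namespace KernelDecay

/-- A function bounded below by a positive constant on a left half-line is not integrable there. -/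
theorem not_integrableOn_Iic_of_le {f : ℝ → ℝ} {y₀ c : ℝ} (hc : 0 < c)
    (hf : ∀ x ≤ y₀, c ≤ f x) : ¬ IntegrableOn f (Iic y₀) := by
  intro hint
  have h1 : ∫⁻ x in Iic y₀, ENNReal.ofReal c ≤ ∫⁻ x in Iic y₀, ‖f x‖ₑ := by
    refine setLIntegral_mono' measurableSet_Iic fun x hx => ?_
    exact (ENNReal.ofReal_le_ofReal (hf x hx)).trans (Real.ofReal_le_enorm (f x))
  have h2 : ∫⁻ x in Iic y₀, ENNReal.ofReal c = ⊤ := by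
    rw [setLIntegral_const, Real.volume_Iic, ENNReal.mul_top (by simpa using hc)]
  have h3 := hint.hasFiniteIntegral
  rw [HasFiniteIntegral] at h3
  rw [h2] at h1
  exact absurd (le_antisymm le_top h1) h3.ne

/-- Derivative of a square along `HasDerivAt`. -/
theorem hasDerivAt_sq {a : ℝ → ℝ} {a' x : ℝ} (h : HasDerivAt a a' x) :
    HasDerivAt (fun y => a y ^ 2) (2 * a x * a') x := by
  have h2 := h.fun_mul h
  have heq : (fun y => a y ^ 2) = fun y => a y * a y := funext fun y => sq (a y)
  rw [heq]
  exact h2.congr_deriv (by ring)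

variable {V a a' : ℝ → ℝ} {X C κ : ℝ}

/-- Under `a'' = V a`, `V ≥ 0` on `(−∞, X)`: the derivative `q = 2 a a'` of `a²` is non-decreasing. -/
theorem monotoneOn_two_mul (hV0 : ∀ x, 0 ≤ V x)
    (ha : ∀ x < X, HasDerivAt a (a' x) x) (ha' : ∀ x < X, HasDerivAt a' (V x * a x) x) :
    MonotoneOn (fun x => 2 * a x * a' x) (Iio X) := by
  have hd : ∀ x < X, HasDerivAt (fun x => 2 * a x * a' x)
      (2 * a' x * a' x + 2 * a x * (V x * a x)) x := fun x hx =>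
    ((ha x hx).const_mul 2).fun_mul (ha' x hx)
  refine monotoneOn_of_deriv_nonneg (convex_Iio X)
    (fun x hx => (hd x hx).continuousAt.continuousWithinAt) ?_ ?_
  · rw [interior_Iio]
    exact fun x hx => (hd x hx).differentiableAt.differentiableWithinAt
  · rw [interior_Iio]
    intro x hx
    rw [(hd x hx).deriv]
    nlinarith [hV0 x, sq_nonneg (a' x), sq_nonneg (a x), mul_nonneg (hV0 x) (sq_nonneg (a x))]

/-- Under `a'' = V a`, `V ≥ 0` on `(−∞, X)` and `a² ∈ L¹(−∞, X)`: `q = 2 a a' ≥ 0`. -/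
theorem two_mul_nonneg (hV0 : ∀ x, 0 ≤ V x)
    (ha : ∀ x < X, HasDerivAt a (a' x) x) (ha' : ∀ x < X, HasDerivAt a' (V x * a x) x)
    (hint : IntegrableOn (fun x => a x ^ 2) (Iio X)) :
    ∀ x < X, 0 ≤ 2 * a x * a' x := by
  intro x₁ hx₁
  by_contra hneg
  push Not at hneg
  set δ : ℝ := -(2 * a x₁ * a' x₁) with hδ
  have hδpos : 0 < δ := by rw [hδ]; linarith
  have hmono := monotoneOn_two_mul hV0 ha ha'
  -- `a²` has derivative `q ≤ -δ` on `(-∞, x₁]`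
  have hsq : ∀ x < X, HasDerivAt (fun x => a x ^ 2) (2 * a x * a' x) x := fun x hx =>
    hasDerivAt_sq (ha x hx)
  have hgrow : ∀ y ≤ x₁, a x₁ ^ 2 + δ * (x₁ - y) ≤ a y ^ 2 := by
    intro y hy
    have key := (convex_Iic x₁).image_sub_le_mul_sub_of_deriv_le
      (f := fun x => a x ^ 2)
      (fun x hx => (hsq x (lt_of_le_of_lt (Set.mem_Iic.mp hx) hx₁)).continuousAt.continuousWithinAt)
      (by
        rw [interior_Iic]
        exact fun x hx => (hsq x ((Set.mem_Iio.mp hx).trans hx₁)).differentiableAt.differentiableWithinAt)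
      (C := -δ)
      (by
        rw [interior_Iic]
        intro x hx
        have hx' : x < x₁ := Set.mem_Iio.mp hx
        rw [(hsq x (hx'.trans hx₁)).deriv, hδ, neg_neg]
        exact hmono (Set.mem_Iio.mpr (hx'.trans hx₁)) (Set.mem_Iio.mpr hx₁) hx'.le)
      y hy x₁ Set.self_mem_Iic hy
    linarith
  -- hence `a² ≥ 1` on `(-∞, x₁ - 1/δ]`, contradicting integrability
  have hone : ∀ y ≤ x₁ - 1 / δ, (1 : ℝ) ≤ a y ^ 2 := by
    intro y hy
    have h1 : 1 / δ ≤ x₁ - y := by linarith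
    have h2 : 1 ≤ δ * (x₁ - y) := by
      have := mul_le_mul_of_nonneg_left h1 hδpos.le
      rwa [mul_one_div_cancel hδpos.ne'] at this
    have h3 := hgrow y (by linarith [one_div_pos.mpr hδpos])
    nlinarith [sq_nonneg (a x₁)]
  have hlt : x₁ - 1 / δ < X := by linarith [one_div_pos.mpr hδpos]
  have hsub : Iic (x₁ - 1 / δ) ⊆ Iio X := fun y hy => lt_of_le_of_lt (Set.mem_Iic.mp hy) hlt
  exact not_integrableOn_Iic_of_le one_pos hone (hint.mono_set hsub)

/-- Under the same hypotheses `a²` is non-decreasing on `(−∞, X)`. -/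
theorem monotoneOn_sq (hV0 : ∀ x, 0 ≤ V x)
    (ha : ∀ x < X, HasDerivAt a (a' x) x) (ha' : ∀ x < X, HasDerivAt a' (V x * a x) x)
    (hint : IntegrableOn (fun x => a x ^ 2) (Iio X)) :
    MonotoneOn (fun x => a x ^ 2) (Iio X) := by
  have hsq : ∀ x < X, HasDerivAt (fun x => a x ^ 2) (2 * a x * a' x) x := fun x hx =>
    hasDerivAt_sq (ha x hx)
  refine monotoneOn_of_deriv_nonneg (convex_Iio X)
    (fun x hx => (hsq x hx).continuousAt.continuousWithinAt) ?_ ?_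
  · rw [interior_Iio]
    exact fun x hx => (hsq x hx).differentiableAt.differentiableWithinAt
  · rw [interior_Iio]
    intro x hx
    rw [(hsq x hx).deriv]
    exact two_mul_nonneg hV0 ha ha' hint x hx

/-- Under the same hypotheses `a²` becomes arbitrarily small towards `−∞`. -/
theorem sq_eventually_le (hV0 : ∀ x, 0 ≤ V x)
    (ha : ∀ x < X, HasDerivAt a (a' x) x) (ha' : ∀ x < X, HasDerivAt a' (V x * a x) x)
    (hint : IntegrableOn (fun x => a x ^ 2) (Iio X)) {ε : ℝ} (hε : 0 < ε) :
    ∃ y < X, ∀ y' ≤ y, a y' ^ 2 < ε := by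
  by_contra h
  push Not at h
  have hmono := monotoneOn_sq hV0 ha ha' hint
  -- then `a² ≥ ε` on `(-∞, X - 1]`
  have hge : ∀ y ≤ X - 1, ε ≤ a y ^ 2 := by
    intro y hy
    obtain ⟨y', hy', hε'⟩ := h y (by linarith)
    have hyX : y < X := by linarith
    exact hε'.trans (hmono (Set.mem_Iio.mpr (lt_of_le_of_lt hy' hyX)) (Set.mem_Iio.mpr hyX) hy')
  have hlt : X - 1 < X := by linarith
  have hsub : Iic (X - 1) ⊆ Iio X := fun y hy => lt_of_le_of_lt (Set.mem_Iic.mp hy) hlt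
  exact not_integrableOn_Iic_of_le hε hge (hint.mono_set hsub)

/-- `∫_y^s C e^{κu} du ≤ (C/κ) e^{κ s}` (any `y, s`; `0 ≤ C`, `0 < κ`). -/
theorem integral_exp_le {C κ : ℝ} (hC : 0 ≤ C) (hκ : 0 < κ) (y s : ℝ) :
    ∫ u in y..s, C * Real.exp (κ * u) ≤ C / κ * Real.exp (κ * s) := by
  have hd : ∀ u, HasDerivAt (fun u => C / κ * Real.exp (κ * u)) (C * Real.exp (κ * u)) u := by
    intro u
    have h1 : HasDerivAt (fun u => κ * u) κ u := by simpa using (hasDerivAt_id u).const_mul κ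
    have hκ0 : κ ≠ 0 := hκ.ne'
    refine (h1.exp.const_mul (C / κ)).congr_deriv ?_
    field_simp
  rw [integral_eq_sub_of_hasDerivAt (fun u _ => hd u)
    ((by fun_prop : Continuous fun u => C * Real.exp (κ * u)).intervalIntegrable _ _)]
  have : 0 ≤ C / κ * Real.exp (κ * y) := by positivity
  linarith

/-- Core step.  On an interval `D = (−∞, x]` or `[z, x]` inside `(−∞, X)` on which `a > 0`,
`a' ≥ 0` and `a' ≤ Φ a` with `Φ(s) = (C/κ)e^{κs}`, the function `w = a · exp(−(C/κ²)e^{κ·})` is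
non-increasing; if moreover `a` takes values below every `ε > 0` on `D` to the left of `x`, then
`a x ≤ 0`. -/
theorem nonpos_of_bound {D : Set ℝ} (hD : Convex ℝ D) (hDX : D ⊆ Iio X) {x : ℝ} (hx : x ∈ D)
    (hC : 0 ≤ C) (hκ : 0 < κ)
    (ha : ∀ s < X, HasDerivAt a (a' s) s)
    (hbound : ∀ s ∈ D, a' s ≤ C / κ * Real.exp (κ * s) * a s)
    (hsmall : ∀ ε > 0, ∃ y ∈ D, y ≤ x ∧ 0 ≤ a y ∧ a y < ε) : a x ≤ 0 := by
  set w : ℝ → ℝ := fun s => a s * Real.exp (-(C / κ ^ 2) * Real.exp (κ * s)) with hw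
  have hE : ∀ s, HasDerivAt (fun s => Real.exp (-(C / κ ^ 2) * Real.exp (κ * s)))
      (Real.exp (-(C / κ ^ 2) * Real.exp (κ * s)) * (-(C / κ ^ 2) * (Real.exp (κ * s) * κ))) s := by
    intro s
    have h1 : HasDerivAt (fun s => κ * s) κ s := by
      simpa using (hasDerivAt_id s).const_mul κ
    have h2 := h1.exp
    have h3 := h2.const_mul (-(C / κ ^ 2))
    exact h3.exp
  have hwd : ∀ s < X, HasDerivAt w
      (a' s * Real.exp (-(C / κ ^ 2) * Real.exp (κ * s))
        + a s * (Real.exp (-(C / κ ^ 2) * Real.exp (κ * s)) * (-(C / κ ^ 2) * (Real.exp (κ * s) * κ)))) s :=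
    fun s hs => (ha s hs).mul (hE s)
  have hanti : AntitoneOn w D := by
    refine antitoneOn_of_deriv_nonpos hD
      (fun s hs => (hwd s (hDX hs)).continuousAt.continuousWithinAt)
      (fun s hs => (hwd s (hDX (interior_subset hs))).differentiableAt.differentiableWithinAt) ?_
    intro s hs
    have hsD : s ∈ D := interior_subset hs
    rw [(hwd s (hDX hsD)).deriv]
    have hb := hbound s hsD
    have hpos : 0 < Real.exp (-(C / κ ^ 2) * Real.exp (κ * s)) := Real.exp_pos _
    have hκ2 : κ ^ 2 = κ * κ := sq κ
    have : a' s * Real.exp (-(C / κ ^ 2) * Real.exp (κ * s))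
        + a s * (Real.exp (-(C / κ ^ 2) * Real.exp (κ * s)) * (-(C / κ ^ 2) * (Real.exp (κ * s) * κ)))
        = Real.exp (-(C / κ ^ 2) * Real.exp (κ * s)) * (a' s - C / κ * Real.exp (κ * s) * a s) := by
      field_simp
      ring
    rw [this]
    exact mul_nonpos_of_nonneg_of_nonpos hpos.le (by linarith)
  -- `w x ≤ w y ≤ a y < ε` for suitable `y`, every `ε > 0`
  have hwx : ∀ ε > 0, w x < ε := by
    intro ε hε
    obtain ⟨y, hyD, hyx, hay0, hay⟩ := hsmall ε hε
    have h1 : w x ≤ w y := hanti hyD hx hyx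
    have h2 : w y ≤ a y := by
      simp only [hw]
      have : Real.exp (-(C / κ ^ 2) * Real.exp (κ * y)) ≤ 1 := by
        apply Real.exp_le_one_iff.mpr
        have : 0 ≤ C / κ ^ 2 * Real.exp (κ * y) := by positivity
        linarith
      calc a y * Real.exp (-(C / κ ^ 2) * Real.exp (κ * y)) ≤ a y * 1 :=
            mul_le_mul_of_nonneg_left this hay0
        _ = a y := mul_one _
    linarith
  have hwx0 : w x ≤ 0 := le_of_forall_pos_lt_add (fun ε hε => by linarith [hwx ε hε])
  have hpos : 0 < Real.exp (-(C / κ ^ 2) * Real.exp (κ * x)) := Real.exp_pos _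
  by_contra hax
  push Not at hax
  have : 0 < w x := mul_pos hax hpos
  linarith

end KernelDecay

end

end Summit.FinalStateConjecture.FinalStateConjecture.Theorems
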